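import Mathlib
import HarnessLib
import Summits.AtomisticToContinuum.FouriersLaw.Theorems.VanishingNoiseTransferVanishingNoiseBoundStubForwardFieldLeakFree
import Summits.AtomisticToContinuum.FouriersLaw.Theorems.VanishingNoiseBound.Negative.WindowTwoChannel

/-!
# `VanishingNoiseBound` — negative-side support: the interior-dark current carrier
(crux `VanishingNoiseTransfer.VanishingNoiseBound`, item stmt-AtomisticToContinuum-11976; line
`energy-dipole-leak-coercivity`, lead a2; `--supports` file, nothing here closes the item)

The line's static stub S1 `stub_windowTwoChannel` was refuted by the deterministic equilibrium forward field
`g₀` (`Negative.WindowTwoChannel`, p132995), using the two landed identity stubs S2 (even leak) and S3 (odd pair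
radiation) at `ε = 0`. This file records the GENERAL fact behind that refutation, so that no reshape of the
static kind is filed again:

* `forwardField_interiorPairing_eq` — for ANY flip rate `ε`, every classical `C²`, `e^{H/4T}`-bounded forward
  field `g` of `(L_{T,T} + εS) g = −(p_0² − T)`, every interior window `[lo, hi] ⊆ [1, L−2]` and every smooth
  window-local far-vanishing test function `φ` (NO parity assumption):
  `∫ g · X_H φ dμ_T = ε ∫ (Sφ) · g dμ_T`. (S2 is the case `Sφ = 0`; S3 bounds the case `Sφ = −4φ`.)
* `forwardField_interiorPairing_eq_zero` — at `ε = 0` the forward field is DARK in every interior window: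
  all interior pairings vanish.
* `exists_interiorDark_currentCarrier` — hence for all parameters `> 0`, `T > 0` and EVERY length `L ≥ 2` there
  is a smooth `g ∈ L²(μ_T)` (namely `g₀`, `exists_plainForwardField_expBound`) whose interior pairings all
  vanish while `∫ g j_i dμ_T < 0` at EVERY bond (`helper_flipBondResponseIdentity` + `flipKubo_pos_and_le` at
  `ε = 0`).
* `staticInteriorCriterion_false` — so no criterion of the shape "f dark in all interior windows ⇒ f carries
  no current across bond i" holds at any length and any bond; a fortiori no inequality
  `(∫ j_i f dμ_T)² ≤ RHS(f)` with `RHS` vanishing on interior-dark `f` (S1 and all its static reshapes: other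
  parities, other window functionals, KLO-type seminorms restricted to interior windows) can be true at finite `N`.

What is deliberately NOT here: the dynamic obstruction (at fixed `L`, `ε ↓ 0`, the true forward fields
`g_ε → g₀`, so no per-bond bound `(∫ g_ε j_i)² ≤ C ε·(local flip mass)` with `ε`-uniform `C` and admissible
lengths can hold) — its kernel version needs the `ε > 0` forward fields, which the tree constructs only under weak
uniqueness of the equilibrium flip-steady state; it is recorded in prose in the line's dead note.

References: Bernardin–Olla 2011 §2.1 (`S` symmetric, `X_H` antisymmetric, baths symmetric under `μ_T`); folklore.
-/

noncomputable section

open MeasureTheory Filter Topology Finset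
open scoped ContDiff
open Literature.MathematicalPhysics.KineticTheory.HeatConduction
open Literature.MathematicalPhysics.KineticTheory OscillatorChain
open Summit.AtomisticToContinuum.FouriersLaw.Theorems.SuperadditiveResistance.DeviceLiouville
  (kin liouvilleOp bathOp kin_eq_sq)
open Summit.AtomisticToContinuum.FouriersLaw.Cruxes.SuperadditiveResistance.FloatingProbeBypassLaplacian
  (pinnedChain_memLp_two_snd_sq integral_mul_sq_sub_gibbsMeasure_eq_zero)
open Summit.AtomisticToContinuum.FouriersLaw.Cruxes.ConductanceLowerBound.ForecastSensitivity
  (integral_cross_eq)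

namespace Summit.AtomisticToContinuum.FouriersLaw.Theorems.VanishingNoiseBound.Negative.InteriorDarkCarrier

/-! ## The interior pairing identity at every flip rate -/

section Pairing

variable {ω₂ lam β γ : ℝ}

/-- **Interior pairings of a flip forward field.** For the pinned chain (all parameters `> 0`), `T > 0`,
`L ≥ 2`, any `ε`, every classical `C²`, `e^{H/4T}`-bounded solution `g` of `(L_{T,T} + εS) g = −(p_0² − T)`,
every window `[lo, hi] ⊆ [1, L−2]` and every smooth `φ` that depends only on the window coordinates and
vanishes as soon as one of them is `≥ R` in size (no parity assumption):
`∫ g · X_H φ dμ_T = ε ∫ (Sφ) · g dμ_T`. Proof: cross Green identity `integral_cross_eq` for the forward pair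
`(g, k_0 + εSg)` against the backward pair `(φ, X_H φ)` (`S_B φ = 0` on an interior window), then
`⟨φ, p_0² − T⟩_{μ_T} = 0` (`φ` does not see `p_0`) and `⟨φ, Sg⟩ = ⟨Sφ, g⟩` (`S` symmetric under `μ_T`).
[cite: BernardinOlla2011, §2.1] -/
theorem forwardField_interiorPairing_eq (hω : 0 < ω₂) (hl : 0 < lam) (hβ : 0 < β) (hγ : 0 < γ) {T : ℝ}
    (hT : 0 < T) (ε : ℝ) {L : ℕ} (hL : 2 ≤ L) {g : PhaseSpace L → ℝ} (hg2 : ContDiff ℝ 2 g)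
    (hgb : ∃ C₀ : ℝ, ∀ u, |g u| ≤ C₀ * Real.exp (1 / (4 * T) * (pinnedChain ω₂ lam β γ).hamiltonian L u))
    (hpde : ∀ u, (pinnedChain ω₂ lam β γ).flipGenerator L T T ε g u = -(kin L 0 u - T))
    {lo hi : ℕ} (hlo : 1 ≤ lo) (hhi : hi + 2 ≤ L) {φ : PhaseSpace L → ℝ} (hφ : ContDiff ℝ ∞ φ)
    (hdep : ∀ u v : PhaseSpace L,
      (∀ k : Fin L, lo ≤ k.val → k.val ≤ hi → u.1 k = v.1 k ∧ u.2 k = v.2 k) → φ u = φ v)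
    (hvan : ∃ R : ℝ, ∀ u : PhaseSpace L,
      (∃ k : Fin L, lo ≤ k.val ∧ k.val ≤ hi ∧ (R ≤ |u.1 k| ∨ R ≤ |u.2 k|)) → φ u = 0) :
    ∫ u, g u * liouvilleOp (pinnedChain ω₂ lam β γ) L φ u ∂((pinnedChain ω₂ lam β γ).gibbsMeasure L T) =
      ε * ∫ u, flipNoise L φ u * g u ∂((pinnedChain ω₂ lam β γ).gibbsMeasure L T) := by
  -- adapted from `VanishingNoiseBound.forwardField_leakFree` (tree file
  -- `…VanishingNoiseBoundStubForwardFieldLeakFree.lean`), parity hypothesis removed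
  have hL0 : 0 < L := by omega
  set P := pinnedChain ω₂ lam β γ with hP
  set μ := P.gibbsMeasure L T with hμdef
  set B := OscillatorChain.bathWeight L with hB
  haveI : IsProbabilityMeasure μ := pinnedChain_isProbabilityMeasure_gibbsMeasure hω hl.le hβ.le γ L hT
  have hflip := gibbs_flipInvariant (ω₂ := ω₂) (lam := lam) (β := β) (γ := γ) L T
  -- regularity of `g`
  obtain ⟨C₀, hC₀⟩ := hgb
  have h14 : 2 * (1 / (4 * T)) < 1 / T := by
    rw [show 2 * (1 / (4 * T)) = 1 / (2 * T) by field_simp; ring, div_lt_div_iff₀ (by positivity) hT]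
    nlinarith
  have hgL : MemLp g 2 μ :=
    memLp_two_of_abs_le_exp_hamiltonian hω hl.le hβ.le γ L hT h14 hg2.continuous hC₀
  -- regularity of `φ` and `X_H φ`
  have hφ2 : ContDiff ℝ 2 φ := hφ.of_le (by norm_cast)
  obtain ⟨hφL2, hXφL2⟩ := memLp_two_of_windowLocal hω hl.le hβ.le γ hT hφ2 hdep hvan
  -- the sources
  have hk0L2 : MemLp (fun x => kin L 0 x - T) 2 μ :=
    ((pinnedChain_memLp_two_snd_sq hω hl.le hβ.le γ L hT ⟨0, hL0⟩).sub (memLp_const T)).ae_eq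
      (ae_of_all _ fun x => by simp [kin_eq_sq hL0])
  have hSgL2 : MemLp (flipNoise L g) 2 μ := memLp_flipNoise hflip hgL
  set k' : PhaseSpace L → ℝ := fun x => (kin L 0 x - T) + ε * flipNoise L g x with hk'
  have hk'L2 : MemLp k' 2 μ := hk0L2.add (hSgL2.const_mul ε)
  -- the two pairs
  have hB0 : ∀ i, 0 ≤ B i := by
    intro i
    simp only [hB, OscillatorChain.bathWeight]
    positivity
  have hpg : ∀ x, 1 * liouvilleOp P L g x + γ * bathOp L B T g x = -k' x := fun x =>
    flip_forwardPair (ω₂ := ω₂) (lam := lam) (β := β) (γ := γ) L T ε (k := fun y => kin L 0 y - T) hpde x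
  have hpφ : ∀ x, -1 * liouvilleOp P L φ x + γ * bathOp L B T φ x = -(liouvilleOp P L φ x) := by
    intro x
    rw [hB, bathOp_bathWeight_eq_zero_of_window hdep hlo hhi T x]
    ring
  -- the cross identity, cutoff removed, in Gibbs-measure form
  have hρeq : ∫ x, φ x * k' x * P.gibbsDensity L T x =
      ∫ x, g x * liouvilleOp P L φ x * P.gibbsDensity L T x :=
    integral_cross_eq hω hl.le hβ.le L hT B hB0 1 hγ hg2 hφ2 hgL hk'L2 hφL2 hXφL2 hpg hpφ
  have hμeq : ∫ x, g x * liouvilleOp P L φ x ∂μ = ∫ x, φ x * k' x ∂μ := by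
    rw [P.integral_gibbsMeasure, P.integral_gibbsMeasure, hρeq]
  -- `⟨φ, k'⟩ = ⟨φ, k_0⟩ + ε⟨φ, Sg⟩ = 0 + ε⟨Sφ, g⟩`
  have hφk0 : ∫ x, φ x * (kin L 0 x - T) ∂μ = 0 := by
    have e1 : ∫ x, φ x * (kin L 0 x - T) ∂μ = ∫ x, φ x * (x.2 ⟨0, hL0⟩ ^ 2 - T) ∂μ :=
      integral_congr_ae (ae_of_all _ fun x => by dsimp only; rw [kin_eq_sq hL0])
    rw [e1]
    refine integral_mul_sq_sub_gibbsMeasure_eq_zero hω hl.le hβ.le γ L hT ⟨0, hL0⟩ (fun x t => ?_) hφL2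
    refine hdep _ _ fun k hk1 hk2 => ?_
    have hk0 : k ≠ ⟨0, hL0⟩ := fun h => by
      have h' : k.val = 0 := congrArg Fin.val h
      omega
    simp [hk0]
  have hφS : ∫ x, φ x * flipNoise L g x ∂μ = ∫ x, flipNoise L φ x * g x ∂μ := by
    have hgi : ∀ i, MemLp (fun x => g (momentumFlip i x)) 2 μ := memLp_comp_momentumFlip hflip hgL
    exact integral_mul_flipNoise hflip (hφL2.integrable_mul hgL) (fun i => hφL2.integrable_mul (hgi i))
  have hφk' : ∫ x, φ x * k' x ∂μ = ε * ∫ x, flipNoise L φ x * g x ∂μ := by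
    have i1 : Integrable (fun x => φ x * (kin L 0 x - T)) μ := hφL2.integrable_mul hk0L2
    have i2 : Integrable (fun x => φ x * flipNoise L g x) μ := hφL2.integrable_mul hSgL2
    have e : (fun x => φ x * k' x) = fun x => φ x * (kin L 0 x - T) + ε * (φ x * flipNoise L g x) := by
      funext x; rw [hk']; ring
    rw [e, integral_add i1 (i2.const_mul ε), integral_const_mul, hφS, hφk0]
    ring
  rw [hμeq, hφk']

/-- **At `ε = 0` the forward field is dark in every interior window**: for the deterministic problem
`L_{T,T} g = −(p_0² − T)` every interior pairing `∫ g · X_H φ dμ_T` vanishes (window-local far-vanishing smooth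
`φ`, any parity). [cite: BernardinOlla2011, §2.1] -/
theorem forwardField_interiorPairing_eq_zero (hω : 0 < ω₂) (hl : 0 < lam) (hβ : 0 < β) (hγ : 0 < γ) {T : ℝ}
    (hT : 0 < T) {L : ℕ} (hL : 2 ≤ L) {g : PhaseSpace L → ℝ} (hg2 : ContDiff ℝ 2 g)
    (hgb : ∃ C₀ : ℝ, ∀ u, |g u| ≤ C₀ * Real.exp (1 / (4 * T) * (pinnedChain ω₂ lam β γ).hamiltonian L u))
    (hpde : ∀ u, (pinnedChain ω₂ lam β γ).flipGenerator L T T 0 g u = -(kin L 0 u - T))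
    {lo hi : ℕ} (hlo : 1 ≤ lo) (hhi : hi + 2 ≤ L) {φ : PhaseSpace L → ℝ} (hφ : ContDiff ℝ ∞ φ)
    (hdep : ∀ u v : PhaseSpace L,
      (∀ k : Fin L, lo ≤ k.val → k.val ≤ hi → u.1 k = v.1 k ∧ u.2 k = v.2 k) → φ u = φ v)
    (hvan : ∃ R : ℝ, ∀ u : PhaseSpace L,
      (∃ k : Fin L, lo ≤ k.val ∧ k.val ≤ hi ∧ (R ≤ |u.1 k| ∨ R ≤ |u.2 k|)) → φ u = 0) :
    ∫ u, g u * liouvilleOp (pinnedChain ω₂ lam β γ) L φ u ∂((pinnedChain ω₂ lam β γ).gibbsMeasure L T) =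
      0 := by
  rw [forwardField_interiorPairing_eq hω hl hβ hγ hT 0 hL hg2 hgb hpde hlo hhi hφ hdep hvan, zero_mul]

end Pairing

/-! ## The dark carrier and the class of criteria it kills -/

section Dark

variable {ω₂ lam β γ : ℝ}

/-- **The interior-dark current carrier.** For the pinned chain (all parameters `> 0`), `T > 0` and every
`L ≥ 2` there is a smooth `g ∈ L²(μ_T)` — the deterministic equilibrium forward field `g₀` of the left bath
(`exists_plainForwardField_expBound`) — such that (i) every interior pairing vanishes,
`∫ g · X_H φ dμ_T = 0` for every window `[lo, hi] ⊆ [1, L−2]` and every smooth window-local far-vanishing `φ`,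
and (ii) `g` carries current at every bond: `∫ g · j_i dμ_T < 0` (`= γA − T²`, bond-response identity, and
`γA < T²`, Onsager sign at `ε = 0`). In words: at finite `N` the linear-response corrector of the deterministic
chain is fed only through the baths and is invisible to every interior test function. [folklore]
[cite: BernardinOlla2011, §2.1] -/
theorem exists_interiorDark_currentCarrier (hω : 0 < ω₂) (hl : 0 < lam) (hβ : 0 < β) (hγ : 0 < γ)
    {T : ℝ} (hT : 0 < T) {L : ℕ} (hL : 2 ≤ L) :
    ∃ g : PhaseSpace L → ℝ, ContDiff ℝ ∞ g ∧ MemLp g 2 ((pinnedChain ω₂ lam β γ).gibbsMeasure L T) ∧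
      (∀ (lo hi : ℕ), 1 ≤ lo → hi + 2 ≤ L → ∀ φ : PhaseSpace L → ℝ, ContDiff ℝ ∞ φ →
        (∀ u v : PhaseSpace L,
          (∀ k : Fin L, lo ≤ k.val → k.val ≤ hi → u.1 k = v.1 k ∧ u.2 k = v.2 k) → φ u = φ v) →
        (∃ R : ℝ, ∀ u : PhaseSpace L,
          (∃ k : Fin L, lo ≤ k.val ∧ k.val ≤ hi ∧ (R ≤ |u.1 k| ∨ R ≤ |u.2 k|)) → φ u = 0) →
        ∫ u, g u * liouvilleOp (pinnedChain ω₂ lam β γ) L φ u ∂((pinnedChain ω₂ lam β γ).gibbsMeasure L T) =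
          0) ∧
      ∀ i : Fin L, i.val + 1 < L →
        ∫ u, g u * (pinnedChain ω₂ lam β γ).bondCurrent L i u ∂((pinnedChain ω₂ lam β γ).gibbsMeasure L T) <
          0 := by
  have hL0 : 0 < L := by omega
  set P := pinnedChain ω₂ lam β γ with hP
  set μ := P.gibbsMeasure L T with hμ
  obtain ⟨g, hg, ⟨C₀, hgb⟩, hgen⟩ :=
    WindowTwoChannel.exists_plainForwardField_expBound hω hl.le hβ hγ hL0 hT
  have hg2 : ContDiff ℝ 2 g := hg.of_le (by norm_cast)
  have hpde : ∀ u, P.flipGenerator L T T 0 g u = -(kin L 0 u - T) := by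
    intro u
    rw [OscillatorChain.flipGenerator, hgen u, zero_mul, add_zero, kin_eq_sq hL0]
  have h14 : 2 * (1 / (4 * T)) < 1 / T := by
    rw [show 2 * (1 / (4 * T)) = 1 / (2 * T) by field_simp; ring, div_lt_div_iff₀ (by positivity) hT]
    nlinarith
  have hgL : MemLp g 2 μ := memLp_two_of_abs_le_exp_hamiltonian hω hl.le hβ.le γ L hT h14 hg.continuous hgb
  refine ⟨g, hg, hgL, fun lo hi hlo hhi φ hφ hdep hvan =>
    forwardField_interiorPairing_eq_zero hω hl hβ hγ hT hL hg2 ⟨C₀, hgb⟩ hpde hlo hhi hφ hdep hvan, ?_⟩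
  intro i hiL
  have hbond : ∫ u, g u * P.bondCurrent L i u ∂μ = γ * (∫ u, g u * (kin L 0 u - T) ∂μ) - T ^ 2 :=
    NoisyFourier.FlipCeiling.helper_flipBondResponseIdentity ω₂ lam β γ T 0 hω hl hβ hγ hT L hL g hg2
      hgL hpde i hiL
  have hkubo := (flipKubo_pos_and_le hω hl hβ hγ hT le_rfl hL hg2 hgL hpde).1
  set A := ∫ u, g u * (kin L 0 u - T) ∂μ with hA
  have hγA : γ * A < T ^ 2 := by
    have h1 : 0 < 1 - γ / T ^ 2 * A := (mul_pos_iff_of_pos_left hγ).1 hkubo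
    have hT2 : 0 < T ^ 2 := by positivity
    have h2 : γ / T ^ 2 * A < 1 := by linarith
    have h3 : γ / T ^ 2 * A * T ^ 2 < 1 * T ^ 2 := mul_lt_mul_of_pos_right h2 hT2
    rw [one_mul, show γ / T ^ 2 * A * T ^ 2 = γ * A by field_simp] at h3
    exact h3
  rw [hbond]
  linarith

/-- **No static interior criterion controls the current overlap.** For the pinned chain (all parameters
`> 0`), `T > 0`, EVERY length `L ≥ 2` and EVERY bond `i`, it is false that a smooth `f ∈ L²(μ_T)` whose
interior pairings `∫ f · X_H φ dμ_T` all vanish (all windows `⊆ [1, L−2]`, all smooth window-local far-vanishing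
`φ`) has zero overlap with the bond current `j_i`. Consequently no inequality `(∫ j_i f dμ_T)² ≤ RHS(f)` whose
right-hand side vanishes on interior-dark `f` — the refuted S1 `stub_windowTwoChannel` of line
`energy-dipole-leak-coercivity` and every static reshape of it (other parities, other window functionals,
seminorms of the interior projections of `X_H f`) — can hold at finite `N`. [folklore] -/
theorem staticInteriorCriterion_false (hω : 0 < ω₂) (hl : 0 < lam) (hβ : 0 < β) (hγ : 0 < γ) {T : ℝ}
    (hT : 0 < T) {L : ℕ} (hL : 2 ≤ L) (i : Fin L) (hi : i.val + 1 < L) :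
    ¬ ∀ f : PhaseSpace L → ℝ, ContDiff ℝ ∞ f → MemLp f 2 ((pinnedChain ω₂ lam β γ).gibbsMeasure L T) →
        (∀ (lo hi : ℕ), 1 ≤ lo → hi + 2 ≤ L → ∀ φ : PhaseSpace L → ℝ, ContDiff ℝ ∞ φ →
          (∀ u v : PhaseSpace L,
            (∀ k : Fin L, lo ≤ k.val → k.val ≤ hi → u.1 k = v.1 k ∧ u.2 k = v.2 k) → φ u = φ v) →
          (∃ R : ℝ, ∀ u : PhaseSpace L,
            (∃ k : Fin L, lo ≤ k.val ∧ k.val ≤ hi ∧ (R ≤ |u.1 k| ∨ R ≤ |u.2 k|)) → φ u = 0) →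
          ∫ u, f u * liouvilleOp (pinnedChain ω₂ lam β γ) L φ u
              ∂((pinnedChain ω₂ lam β γ).gibbsMeasure L T) = 0) →
        ∫ u, f u * (pinnedChain ω₂ lam β γ).bondCurrent L i u ∂((pinnedChain ω₂ lam β γ).gibbsMeasure L T) =
          0 := by
  intro h
  obtain ⟨g, hg, hgL, hdark, hcur⟩ := exists_interiorDark_currentCarrier hω hl hβ hγ hT hL
  have h0 := h g hg hgL hdark
  have hneg := hcur i hi
  rw [h0] at hneg
  exact lt_irrefl _ hneg

end Dark

end Summit.AtomisticToContinuum.FouriersLaw.Theorems.VanishingNoiseBound.Negative.InteriorDarkCarrier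

end
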